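import Literature.NumberTheory.Rogawski1990.LocalTransferExplicitNonsplit
import Literature.NumberTheory.Rogawski1990.LocalTransferGlueCM
import Literature.NumberTheory.Automorphic.OrbitalMeasureCanonical
import Literature.NumberTheory.Rogawski1990.LocalTransferGlueNhdsOne
import Literature.NumberTheory.Rogawski1990.UnitFundamentalLemmaExplicitNonsplitClosedProof
import Literature.NumberTheory.Automorphic.IntegralMatrixReduction
import Literature.NumberTheory.Rogawski1990.DepthZeroTransferHValuesTypeOne
import Literature.NumberTheory.Rogawski1990.LocalTransferAtOneOfPopulations
import Literature.NumberTheory.Rogawski1990.LevelOnePieceStrataConstancy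
import Literature.NumberTheory.Rogawski1990.DepthZeroKappaTransferTypeOne
import Literature.NumberTheory.Rogawski1990.DepthZeroKappaTransferTypeTwo
import Literature.NumberTheory.Rogawski1990.DepthZeroKappaTransferLevi
import HarnessLib

/-!
# The Δ‴-transfer at the identity for `K`-class pieces of hyperspecial level ≤ 1 (road «S3-tree», WAYPOINT `…_le_one` of the partial head; Rogawski 1990 §4.9,
# Langlands–Shelstad descent §2.1)

Topic `NumberTheory/Rogawski1990`; namespace `Literature.NumberTheory.Rogawski1990`.  THEOREMS ONLY (no definition, no instance, no notation, no named fact, no `sorry`).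
Cell `pub/hodgecm-mathlib` (D-0151), crux H413 = `stmt-HodgeConjecture-24833`, road «S3-tree» (architect A-p16 A-84 (3)∕A-86∕A-88 (6) «STAGING: `_le_one` first, then
`_le_two := lift`»; LEAD F0P3a-plan; END F0P3a-p03 (g15∕g16)).  HONEST LABEL: HC_CM is proved only modulo the 2 remaining named inputs (hLiu418 24832, h413 24833) until rung 0
closes; this file is count-neutral support for H413 (it does not close the crux).

THE STATEMENT (`localTransferAtOne_of_hyperspecialLevel_le_one`).  `L` CM, `v` a finite place of `L⁺` UNRAMIFIED and NON-SPLIT in `L` (`w` the place above, `hw`), `v ∤ 2`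
(`h2`), `H′` hermitian with GOOD REDUCTION at `w` (`hH′w hH′i`), `μ` a unitary Hecke character extending `ω_{L∕L⁺}` unramified at `w`; `G′_v = (cmDatum L 3 H′).Local v`,
`K = cmLocalIntegralLevel L 3 H′ v` (hyperspecial), `H_v = U(2) × U(1)`, canonical orbital measure families `mG`, `mH` (any Haar normalisations `νG`, `νH` — architect A-79), and
`Δ = ((finExplicitCollection L H′ μ …) v).Δ` Rogawski's explicit transfer factor.  For every piece `g ∈ C_c^∞(G′_v)` supported in `K`, `Ad K`-invariant and LEFT-INVARIANT
UNDER THE LEVEL-1 CONGRUENCE SET «`u_w ≡ 1 (mod ϖ_v)`» (A-69 (β) tokens), there are a neighbourhood `V` of `1 ∈ H_v` and `φH ∈ C_c^∞(H_v)` with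
  `Φ^st(γH, φH) = Σ_c Δ(γH, c) Φ(c, g)` for every `G`-regular `γH ∈ V`
— the conclusion of the letter's `stub_N6nsS3id` (ED. 1.15) at `v` for `g`.

THE PROOF (fold of ★ organs, 15 lines).  (U) ★ `strataConstancy_of_levelOne` (p846483): `g` is constant on the residually-unipotent Jordan strata of `K`, values `c`.  T3′ HEAD v4
★ `depthZeroKappaTransfer_hyperspecial_typeOne` ∕ `…_typeTwo` ∕ `…_levi` (the three populations of `G`-regular `γH` near `1`: elliptic torus with split `χ`, irreducible `χ`,
Levi): `Σ_c Δ Φ(c, g) = a₀·Φ^st(γH, χ₀) + a₁·Φ^st(γH, χ₁)` with `χ₀, χ₁` the residual rank strata of `K_H` and `a₀ = (ν_G(K)∕ν_H(K_H))(q⁻²c₀ + (q²−1)q⁻²c₁)`,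
`a₁ = (ν_G(K)∕ν_H(K_H))(−q⁻¹c₁ + (q+1)q⁻¹c₂)`.  ★ junction `localTransferAtOne_of_populations` (p846349) with `ψ = ![χ₀, χ₁]` (`IsLocSmooth χ_s` ★ p846285) ⇒ `φH := a₀χ₀ + a₁χ₁`.

## References
* [Rogawski1990] J. D. Rogawski, *Automorphic Representations of Unitary Groups in Three Variables*, Ann. of Math. Stud. 123 (1990): §4.9 Prop. 4.9.1 (a)(b) p. 55; §8.1
  Props. 8.1.1–8.1.2 pp. 112–114; §4.3 (4.3.1) p. 43.
* [LanglandsShelstad1990Descent] R. Langlands, D. Shelstad, *Descent for transfer factors*, The Grothendieck Festschrift II (1990): §2.1 (2.1.2).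
* [Kottwitz1986] R. E. Kottwitz, *Base change for unit elements of Hecke algebras*, Compositio Math. 60 (1986): §3.
-/

set_option autoImplicit false

noncomputable section

open NumberField IsDedekindDomain MeasureTheory Measure Topology Filter
open Literature.NumberTheory.Rogawski1990 Literature.NumberTheory.Automorphic Literature.NumberTheory.GaloisRepresentations
open Literature.NumberTheory.Automorphic.UnitaryGroup Literature.NumberTheory.Automorphic.IntegralReduction
open Literature.AlgebraicGeometry.ShimuraVarieties (unitaryGroup hermForm)
open scoped Matrix MatrixGroups Classical ValuativeRel

namespace Literature.NumberTheory.Rogawski1990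

/-! ## The waypoint head -/

/-- **WAYPOINT HEAD «Δ‴-TRANSFER AT THE IDENTITY FOR `K`-CLASS PIECES OF HYPERSPECIAL LEVEL ≤ 1»** (A-88 (6) staging): binders = the PARTIAL HEAD's (sf 82b5f4b7)
with `hg2 ↦ hg1` (exponent `1`); conclusion = `stub_N6nsS3id`'s VERBATIM at `v`.  FOLD: (U) ⇒ strata values `c`; T3′ (P-1)(P-2)(P-3) ⇒ the three rows
`a₀Φ^st(χ₀) + a₁Φ^st(χ₁)`; ★ junction ⇒ `φH := a₀•χ₀ + a₁•χ₁`. [cite: Rogawski1990, §4.9 Prop. 4.9.1 (a)(b) p. 55; §8.1 Prop. 8.1.1 p. 112] [cite: LanglandsShelstad1990Descent, §2.1 (2.1.2)] -/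
theorem localTransferAtOne_of_hyperspecialLevel_le_one
    (L : Type) [Field L] [NumberField L] [IsCMField L] (H' : Matrix (Fin 3) (Fin 3) L) (μ : HeckeCharacter L)
    {v : HeightOneSpectrum (𝓞 ↥(maximalRealSubfield L))}
    (hH' : (H'.map (cmConjRingHom L)).transpose = H') (w : PlacesOver L v)
    (hw : IsCMField.complexConj L • w.1 = w.1) (hv : Algebra.IsUnramifiedIn (𝓞 L) v.asIdeal)
    (hH'w : IsUnit (placeForm H' w.1)) (hH'i : hH'w.unit ∈ glInt 3 (w.1.adicCompletion L))
    (hμ : μ.IsUnramifiedAt w.1) (hμu : μ.IsUnitary)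
    (hμω : ∀ x : ideleGroup ↥(maximalRealSubfield L), μ (AdeleRing.ideleBaseChange ↥(maximalRealSubfield L) L x) = quadraticHeckeCharCM L x)
    (h2 : IsUnit (2 : 𝒪[w.1.adicCompletion L]))
    [MeasurableSpace ((cmDatum L 3 H').Local v)] [BorelSpace ((cmDatum L 3 H').Local v)]
    [∀ γ : ((cmDatum L 3 H').Local v), MeasurableSpace (((cmDatum L 3 H').Local v) ⧸ Subgroup.centralizer ({γ} : Set ((cmDatum L 3 H').Local v)))]
    [∀ γ : ((cmDatum L 3 H').Local v), BorelSpace (((cmDatum L 3 H').Local v) ⧸ Subgroup.centralizer ({γ} : Set ((cmDatum L 3 H').Local v)))]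
    [MeasurableSpace ((cmDatum L 2 (Matrix.of fun i j : Fin 2 => if i.val + j.val + 1 = 2 then (1 : L) else 0)).Local v × (cmDatum L 1 (Matrix.of fun i j : Fin 1 => if i.val + j.val + 1 = 1 then (1 : L) else 0)).Local v)] [BorelSpace ((cmDatum L 2 (Matrix.of fun i j : Fin 2 => if i.val + j.val + 1 = 2 then (1 : L) else 0)).Local v × (cmDatum L 1 (Matrix.of fun i j : Fin 1 => if i.val + j.val + 1 = 1 then (1 : L) else 0)).Local v)]
  [∀ a : (cmDatum L 2 (Matrix.of fun i j : Fin 2 => if i.val + j.val + 1 = 2 then (1 : L) else 0)).Local v × (cmDatum L 1 (Matrix.of fun i j : Fin 1 => if i.val + j.val + 1 = 1 then (1 : L) else 0)).Local v, MeasurableSpace (((cmDatum L 2 (Matrix.of fun i j : Fin 2 => if i.val + j.val + 1 = 2 then (1 : L) else 0)).Local v × (cmDatum L 1 (Matrix.of fun i j : Fin 1 => if i.val + j.val + 1 = 1 then (1 : L) else 0)).Local v) ⧸ Subgroup.centralizer ({a} : Set ((cmDatum L 2 (Matrix.of fun i j : Fin 2 => if i.val + j.val + 1 = 2 then (1 :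 L) else 0)).Local v × (cmDatum L 1 (Matrix.of fun i j : Fin 1 => if i.val + j.val + 1 = 1 then (1 : L) else 0)).Local v)))]
  [∀ a : (cmDatum L 2 (Matrix.of fun i j : Fin 2 => if i.val + j.val + 1 = 2 then (1 : L) else 0)).Local v × (cmDatum L 1 (Matrix.of fun i j : Fin 1 => if i.val + j.val + 1 = 1 then (1 : L) else 0)).Local v, BorelSpace (((cmDatum L 2 (Matrix.of fun i j : Fin 2 => if i.val + j.val + 1 = 2 then (1 : L) else 0)).Local v × (cmDatum L 1 (Matrix.of fun i j : Fin 1 => if i.val + j.val + 1 = 1 then (1 : L) else 0)).Local v) ⧸ Subgroup.centralizer ({a} : Set ((cmDatum L 2 (Matrix.of fun i j : Fin 2 => if i.val + j.val + 1 = 2 then (1 : L) else 0)).Local v × (cmDatum L 1 (Matrix.of fun i j : Fin 1 => if i.val + j.val + 1 = 1 then (1 : L) else 0)).Local v)))]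
    (νH : Measure ((cmDatum L 2 (Matrix.of fun i j : Fin 2 => if i.val + j.val + 1 = 2 then (1 : L) else 0)).Local v × (cmDatum L 1 (Matrix.of fun i j : Fin 1 => if i.val + j.val + 1 = 1 then (1 : L) else 0)).Local v)) [νH.IsHaarMeasure] [νH.IsMulRightInvariant]
    (νG : Measure ((cmDatum L 3 H').Local v)) [νG.IsHaarMeasure] [νG.IsMulRightInvariant]
    {mH : OrbitalMeasureFamily ((cmDatum L 2 (Matrix.of fun i j : Fin 2 => if i.val + j.val + 1 = 2 then (1 : L) else 0)).Local v × (cmDatum L 1 (Matrix.of fun i j : Fin 1 => if i.val + j.val + 1 = 1 then (1 : L) else 0)).Local v)} {mG : OrbitalMeasureFamily ((cmDatum L 3 H').Local v)}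
    (hmH : mH.IsCanonical (IsLocalGRegular L v) νH)
    (hmG : mG.IsCanonical (fun γ => IsRegularElt (γ.val : GL (Fin 3) (UnitaryGroup.LocalRing L v))) νG)
    -- the piece: `C_c^∞`, supported in the hyperspecial `K`, `Ad K`-invariant, left-invariant under the level-2 congruence set (A-69 (β), `j = 2`)
    (g : ((cmDatum L 3 H').Local v) → ℂ) (hg : IsLocSmooth g) (hgK : tsupport g ⊆ (cmLocalIntegralLevel L 3 H' v : Set ((cmDatum L 3 H').Local v)))
    (hginv : ∀ u ∈ cmLocalIntegralLevel L 3 H' v, ∀ x, g (u * x * u⁻¹) = g x)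
    (hg1 : ∀ u : (cmDatum L 3 H').Local v,
      (∀ a b, Valued.v (((toPlace v w (HeckeCharacter.uniformizer ↥(maximalRealSubfield L) v : v.adicCompletion ↥(maximalRealSubfield L))) ^ 1)⁻¹ *
        ((((localNonsplitEquiv (IsCMField.complexConj L) H' (IsCMField.complexConj_ne_one L) w hw u :
            ↥(unitaryGroupOfForm (galAdicCompletionMap (L := L) (IsCMField.complexConj L) hw) (placeForm H' w.1))) : GL (Fin 3) (w.1.adicCompletion L)) :
              Matrix (Fin 3) (Fin 3) (w.1.adicCompletion L)) a b - (1 : Matrix (Fin 3) (Fin 3) (w.1.adicCompletion L)) a b)) ≤ 1) →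
      ∀ x, g (u * x) = g x) :
    ∃ V ∈ 𝓝 (1 : ((cmDatum L 2 (Matrix.of fun i j : Fin 2 => if i.val + j.val + 1 = 2 then (1 : L) else 0)).Local v × (cmDatum L 1 (Matrix.of fun i j : Fin 1 => if i.val + j.val + 1 = 1 then (1 : L) else 0)).Local v)), ∃ φH : ((cmDatum L 2 (Matrix.of fun i j : Fin 2 => if i.val + j.val + 1 = 2 then (1 : L) else 0)).Local v × (cmDatum L 1 (Matrix.of fun i j : Fin 1 => if i.val + j.val + 1 = 1 then (1 : L) else 0)).Local v) → ℂ, IsLocSmooth φH ∧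
      ∀ γH ∈ V, IsLocalGRegular L v γH →
        stableOrbitalIntegralRel (IsLocalStablyConjH L v) mH φH γH =
          ∑ᶠ c : ConjClasses ((cmDatum L 3 H').Local v),
            ((finExplicitCollection L H' μ (finExplicitDelta_conj_left_all L H' μ) (finExplicitDelta_conj_right_all L H' μ)) v).Δ γH (Quotient.out c) *
              classOrbitalIntegral mG g c := by
  obtain ⟨c, hc⟩ := strataConstancy_of_levelOne L H' hH' w hw hv hH'w hH'i h2 g hginv hg1
  obtain ⟨V₁, hV₁, h₁⟩ := depthZeroKappaTransfer_hyperspecial_typeOne L H' μ hH' w hw hv hH'w hH'i hμ hμu hμω h2 νH νG hmH hmG g hg hgK hginv c hc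
  obtain ⟨V₂, hV₂, h₂⟩ := depthZeroKappaTransfer_hyperspecial_typeTwo L H' μ hH' w hw hv hH'w hH'i hμ hμu hμω h2 νH νG hmH hmG g hg hgK hginv c hc
  obtain ⟨V₃, hV₃, h₃⟩ := depthZeroKappaTransfer_hyperspecial_levi L H' μ hH' w hw hv hH'w hH'i hμ hμu hμω h2 νH νG hmH hmG g hg hgK hginv c hc
  refine localTransferAtOne_of_populations L H' v w hmH.isAdmissibleOn _ mG g
    ![((((cmLocalIntegralLevel L 2 (Matrix.of fun i j : Fin 2 => if i.val + j.val + 1 = 2 then (1 : L) else 0) v).prod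
                (cmLocalIntegralLevel L 1 (Matrix.of fun i j : Fin 1 => if i.val + j.val + 1 = 1 then (1 : L) else 0) v) : Subgroup _) : Set _).indicator
              (fun h => if (redMat (((h.1.val : GL (Fin 2) (UnitaryGroup.LocalRing L v)).val.map (Pi.evalRingHom (fun w' : PlacesOver L v => w'.1.adicCompletion L) w))) - 1) ^ 2 = 0 ∧ (redMat (((h.1.val : GL (Fin 2) (UnitaryGroup.LocalRing L v)).val.map (Pi.evalRingHom (fun w' : PlacesOver L v => w'.1.adicCompletion L) w))) - 1).rank = 0 then (1 : ℂ) else 0)),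
      ((((cmLocalIntegralLevel L 2 (Matrix.of fun i j : Fin 2 => if i.val + j.val + 1 = 2 then (1 : L) else 0) v).prod
                (cmLocalIntegralLevel L 1 (Matrix.of fun i j : Fin 1 => if i.val + j.val + 1 = 1 then (1 : L) else 0) v) : Subgroup _) : Set _).indicator
              (fun h => if (redMat (((h.1.val : GL (Fin 2) (UnitaryGroup.LocalRing L v)).val.map (Pi.evalRingHom (fun w' : PlacesOver L v => w'.1.adicCompletion L) w))) - 1) ^ 2 = 0 ∧ (redMat (((h.1.val : GL (Fin 2) (UnitaryGroup.LocalRing L v)).val.map (Pi.evalRingHom (fun w' : PlacesOver L v => w'.1.adicCompletion L) w))) - 1).rank = 1 then (1 : ℂ) else 0))]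
    ?_ ![((νG.real (cmLocalIntegralLevel L 3 H' v : Set ((cmDatum L 3 H').Local v)) / νH.real (((cmLocalIntegralLevel L 2 (Matrix.of fun i j : Fin 2 => if i.val + j.val + 1 = 2 then (1 : L) else 0) v).prod
                (cmLocalIntegralLevel L 1 (Matrix.of fun i j : Fin 1 => if i.val + j.val + 1 = 1 then (1 : L) else 0) v) : Subgroup _) : Set _) : ℝ) : ℂ) * (((Ideal.absNorm v.asIdeal : ℂ) ^ 2)⁻¹ * c 0 + (((Ideal.absNorm v.asIdeal : ℂ) ^ 2 - 1) / (Ideal.absNorm v.asIdeal : ℂ) ^ 2) * c 1), ((νG.real (cmLocalIntegralLevel L 3 H' v : Set ((cmDatum L 3 H').Local v)) / νH.real (((cmLocalIntegralLevel L 2 (Matrix.of fun i j : Fin 2 => if i.val + j.val + 1 = 2 then (1 : L) else 0) v).prod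
                (cmLocalIntegralLevel L 1 (Matrix.of fun i j : Fin 1 => if i.val + j.val + 1 = 1 then (1 : L) else 0) v) : Subgroup _) : Set _) : ℝ) : ℂ) * (-((Ideal.absNorm v.asIdeal : ℂ))⁻¹ * c 1 + (((Ideal.absNorm v.asIdeal : ℂ) + 1) / (Ideal.absNorm v.asIdeal : ℂ)) * c 2)] ⟨V₁, hV₁, fun γH hγ hreg hS hL => (h₁ γH hγ hreg hS hL).trans ?_⟩ ⟨V₂, hV₂, fun γH hγ hreg hS => (h₂ γH hγ hreg hS).trans ?_⟩
      ⟨V₃, hV₃, fun γH hγ hreg hL => (h₃ γH hγ hreg hL).trans ?_⟩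
  · intro s
    fin_cases s
    · exact isLocSmooth_indicator_ite_redMat L v w hw 0 _
    · exact isLocSmooth_indicator_ite_redMat L v w hw 1 _
  all_goals simp only [Fin.sum_univ_two, Fin.isValue, Matrix.cons_val_zero, Matrix.cons_val_one]

end Literature.NumberTheory.Rogawski1990

end
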